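import Mathlib
import HarnessLib
import Summits.HubbardSuperconductivity.HubbardSuperconductivity.Theorems.KLProgrammeKLRegimeCountertermJacksonRemainderAngularFactorAE
import Summits.HubbardSuperconductivity.HubbardSuperconductivity.Theorems.KLProgrammeKLRegimeCountertermJacksonRemainderCertDefs
import Summits.HubbardSuperconductivity.HubbardSuperconductivity.Theorems.KLProgrammeKLRegimeCountertermChainRuleFour
import Summits.HubbardSuperconductivity.HubbardSuperconductivity.Theorems.KLProgrammeH10TwoPointLimitPerturbedFermiRadiusSmooth

/-!
# Route `KLProgramme`, crux K3 — gen-8 ENGINE-FLOW child (stmt-HubbardSuperconductivity-20437), stub (C) `stub_twoLeg_curvature`: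
# the (C1) certificate consumer, part 2 — the displaced polar angle is smooth at almost every displacement, and the
# pointwise chain-rule bounds of the displaced angular factor in `bellP` currency

Seat hubbard-kl-k3c3-p1 (g7).  The certificate (`CutoffDefectCert`) bounds products of the displaced cutoff jets with the graded Bell
monomials `P_{j,l}(|α_w′(θ)|, …, |α_w⁗(θ)|)` of the bare displaced polar angle `α_w = certAngle r w`.  Seen from the curve point, the
displacements `w` whose centred displaced point lies on a cell-boundary line, at a lattice point, or on the branch cut of `arg` form
countably many axis-parallel lines: for a.e. `w` the angle `α_w` is `C⁴` on a neighbourhood of `θ` (§1 `ae_jmeas_offGridSlit`,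
`contDiffAt_certAngle`), so part 1's exact chain rule applies to `g∘α_w` (`g = f − mean f`): §2 `abs_iteratedDeriv_comp_certAngle_le`
(`|∂ʲ(g∘α_w)(θ)| ≤ Σ_l a_l·P_{j,l}`) and the transport bound `abs_iteratedDeriv_comp_certAngle_sub_le`
(`|∂ᵏ(g∘α_w)(θ) − g^{(k)}(t)| ≤ Σ_{l<k} a_l P_{k,l} + a_k|α_w′ᵏ − 1| + a_{k+1}|⟨α_w(θ) − t⟩|`), both for a.e. `w`.
Pure real analysis; no definitions; nothing here asserts superconductivity.
-/

noncomputable section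

namespace Summit.HubbardSuperconductivity.HubbardSuperconductivity.Theorems.KLRegimeSplit

set_option linter.dupNamespace false -- summit = problem name (single-conjunct summit), D-0017

open Real MeasureTheory Filter Set
open scoped Topology
open Literature.MathematicalPhysics.QuantumLattice

/-! ## §1 The displaced polar angle is `C⁴` near the base angle for a.e. displacement -/

section Smooth

/-- **The polar angle is smooth off the branch cut**: at a point whose second coordinate is nonzero, `q ↦ polarAngle (ofLp q)` is `C^n`
(`arg = im ∘ log` on the slit plane). -/
theorem contDiffAt_polarAngle_ofLp_of_ne {q : EuclideanSpace ℝ (Fin 2)} (hq : WithLp.ofLp q 1 ≠ 0) {n : ℕ∞} :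
    ContDiffAt ℝ n (fun q : EuclideanSpace ℝ (Fin 2) => polarAngle (WithLp.ofLp q)) q := by
  obtain ⟨ι, hι, -⟩ := exists_momToComplexCLM
  have hslit : ι q ∈ Complex.slitPlane := by
    rw [hι]; exact Or.inr (by rw [momToComplex_im]; exact hq)
  have hfun : (fun q : EuclideanSpace ℝ (Fin 2) => polarAngle (WithLp.ofLp q)) = fun q => (Complex.log (ι q)).im := by
    funext q'; rw [Complex.log_im, hι]; rfl
  rw [hfun]
  have hlog : ContDiffAt ℝ n (fun z : ℂ => Complex.log z) (ι q) :=
    ((Complex.contDiffAt_log hslit (n := n)).restrict_scalars ℝ)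
  have hcomp : ContDiffAt ℝ n (fun q : EuclideanSpace ℝ (Fin 2) => Complex.log (ι q)) q := hlog.comp q ι.contDiff.contDiffAt
  exact (Complex.imCLM.contDiff.contDiffAt).comp q hcomp

/-- **Off the grid and the cut, the bare displaced angle is `C⁴` at the point**: if the centred displaced point is off the cell-boundary
lines and its second coordinate is nonzero, `q ↦ polarAngle (centredRep (ofLp q))` is `C^n` at `q`. -/
theorem contDiffAt_polarAngle_centredRep_of_offGridSlit {q : EuclideanSpace ℝ (Fin 2)} {n : ℕ∞}
    (hne : ∀ i : Fin 2, toIocMod Real.two_pi_pos (-Real.pi) (WithLp.ofLp q i) ≠ -Real.pi + 2 * Real.pi)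
    (h1 : toIocMod Real.two_pi_pos (-Real.pi) (WithLp.ofLp q 1) ≠ 0) :
    ContDiffAt ℝ n (fun q : EuclideanSpace ℝ (Fin 2) => polarAngle (centredRep (WithLp.ofLp q))) q := by
  set z : Fin 2 → ℤ := fun i => toIocDiv Real.two_pi_pos (-Real.pi) (WithLp.ofLp q i) with hz
  set c : EuclideanSpace ℝ (Fin 2) := WithLp.toLp 2 fun i => (z i : ℝ) * (2 * Real.pi) with hc
  have hev1 : ∀ i : Fin 2, ∀ᶠ q' : EuclideanSpace ℝ (Fin 2) in 𝓝 q,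
      toIocMod Real.two_pi_pos (-Real.pi) (WithLp.ofLp q' i) = WithLp.ofLp q' i - (z i : ℝ) * (2 * Real.pi) := by
    intro i
    have hcont : ContinuousAt (fun q' : EuclideanSpace ℝ (Fin 2) => WithLp.ofLp q' i) q :=
      ((continuous_apply i).comp (PiLp.continuous_ofLp 2 _)).continuousAt
    have h2 := hcont.eventually (eventually_toIocMod_eq_sub Real.two_pi_pos (-Real.pi) (hne i))
    filter_upwards [h2] with q' hq'
    rw [hq', zsmul_eq_mul]
  have hevall : ∀ᶠ q' : EuclideanSpace ℝ (Fin 2) in 𝓝 q, ∀ i : Fin 2,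
      toIocMod Real.two_pi_pos (-Real.pi) (WithLp.ofLp q' i) = WithLp.ofLp q' i - (z i : ℝ) * (2 * Real.pi) :=
    Filter.eventually_all.mpr hev1
  have hev : (fun q' : EuclideanSpace ℝ (Fin 2) => polarAngle (centredRep (WithLp.ofLp q'))) =ᶠ[𝓝 q]
      fun q' => (fun p : EuclideanSpace ℝ (Fin 2) => polarAngle (WithLp.ofLp p)) (q' - c) := by
    filter_upwards [hevall] with q' hq'
    have hcen : centredRep (WithLp.ofLp q') = WithLp.ofLp (q' - c) := by
      funext i
      show toIocMod Real.two_pi_pos (-π) (WithLp.ofLp q' i) = _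
      rw [hq' i, WithLp.ofLp_sub, Pi.sub_apply, hc, WithLp.ofLp_toLp]
    simp only [hcen]
  have hq' := hevall.self_of_nhds
  have hqc : WithLp.ofLp (q - c) 1 ≠ 0 := by
    rw [WithLp.ofLp_sub, Pi.sub_apply, hc, WithLp.ofLp_toLp, ← hq' 1]; exact h1
  have hS : ContDiffAt ℝ n (fun p : EuclideanSpace ℝ (Fin 2) => polarAngle (WithLp.ofLp p)) (q - c) :=
    contDiffAt_polarAngle_ofLp_of_ne hqc
  have hshift : ContDiffAt ℝ n (fun q' : EuclideanSpace ℝ (Fin 2) => (fun p : EuclideanSpace ℝ (Fin 2) => polarAngle (WithLp.ofLp p)) (q' - c)) q :=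
    ContDiffAt.comp (f := fun q' : EuclideanSpace ℝ (Fin 2) => q' - c) q hS (contDiff_id.sub contDiff_const).contDiffAt
  exact hshift.congr_of_eventuallyEq hev

/-- **For every base point, a.e. displacement is off the grid AND off the cut**: the exceptional `w` lie on countably many axis-parallel
lines of the smoothing square. -/
theorem ae_jmeas_offGridSlit (x : EuclideanSpace ℝ (Fin 2)) :
    ∀ᵐ w ∂jmeas, (∀ i : Fin 2, toIocMod Real.two_pi_pos (-Real.pi) (WithLp.ofLp (x - jshift w) i) ≠ -Real.pi + 2 * Real.pi) ∧
      toIocMod Real.two_pi_pos (-Real.pi) (WithLp.ofLp (x - jshift w) 1) ≠ 0 := by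
  have hgrid := ae_jmeas_offGrid x
  -- the cut: second centred coordinate `= 0` ⇔ `w.2 ∈ x₁ - 2πℤ`
  set B : Set (ℝ × ℝ) := ⋃ z : ℤ, {w : ℝ × ℝ | w.2 = WithLp.ofLp x 1 - (0 + z • (2 * Real.pi))} with hB
  have hl2 : ∀ a : ℝ, volume {w : ℝ × ℝ | w.2 = a} = 0 := fun a => by
    have e : {w : ℝ × ℝ | w.2 = a} = (Set.univ : Set ℝ) ×ˢ ({a} : Set ℝ) := by ext w; simp
    rw [e, show (volume : Measure (ℝ × ℝ)) = (volume : Measure ℝ).prod volume from rfl, Measure.prod_prod, Real.volume_singleton, mul_zero]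
  have hBnull : volume B = 0 := measure_iUnion_null fun z => hl2 _
  have hsub : {w : ℝ × ℝ | ¬ toIocMod Real.two_pi_pos (-Real.pi) (WithLp.ofLp (x - jshift w) 1) ≠ 0} ⊆ B := by
    intro w hw
    simp only [Set.mem_setOf_eq, not_not] at hw
    obtain ⟨-, h1⟩ := ofLp_sub_jshift_apply x w
    obtain ⟨-, z, hz⟩ := (toIocMod_eq_iff Real.two_pi_pos).1 hw
    simp only [hB, Set.mem_iUnion, Set.mem_setOf_eq]
    refine ⟨z, ?_⟩
    have : WithLp.ofLp (x - jshift w) 1 = 0 + z • (2 * Real.pi) := hz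
    rw [h1] at this; linarith
  have hcut : ∀ᵐ w ∂(volume : Measure (ℝ × ℝ)), toIocMod Real.two_pi_pos (-Real.pi) (WithLp.ofLp (x - jshift w) 1) ≠ 0 := by
    rw [ae_iff]; exact measure_mono_null hsub hBnull
  have hcut' : ∀ᵐ w ∂jmeas, toIocMod Real.two_pi_pos (-Real.pi) (WithLp.ofLp (x - jshift w) 1) ≠ 0 := by
    rw [jmeas_eq_restrict]; exact ae_restrict_of_ae hcut
  filter_upwards [hgrid, hcut'] with w h1 h2
  exact ⟨h1.1, h2⟩

variable {r : ℝ → ℝ}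

/-- The polar curve `r·dir` is `C⁴` when `r` is (`contDiff_dir` of the perturbed-Fermi-curve lineage). -/
theorem contDiff_certCurve (hr : ContDiff ℝ 4 r) : ContDiff ℝ 4 (certCurve r) :=
  (PiLp.contDiff_toLp.comp (hr.smul Summit.HubbardSuperconductivity.HubbardSuperconductivity.Theorems.PerturbedFermiCurve.contDiff_dir) : _)

/-- **For a.e. displacement the bare displaced angle `α_w = certAngle r w` is `C⁴` at the base angle.** -/
theorem ae_jmeas_contDiffAt_certAngle (hr : ContDiff ℝ 4 r) (θ : ℝ) :
    ∀ᵐ w ∂jmeas, ContDiffAt ℝ 4 (certAngle r w) θ := by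
  refine (ae_jmeas_offGridSlit (certCurve r θ)).mono fun w hw => ?_
  have hA := contDiffAt_polarAngle_centredRep_of_offGridSlit (n := 4) hw.1 hw.2
  exact ContDiffAt.comp (f := fun ϑ : ℝ => certCurve r ϑ - jshift w) θ hA ((contDiff_certCurve hr).sub contDiff_const).contDiffAt

end Smooth

/-! ## §2 The pointwise chain-rule bounds of the displaced angular factor, a.e. in the displacement -/

section ChainAE

variable {r g : ℝ → ℝ} {a : ℕ → ℝ}

/-- **A.e. chain bounds.**  For `r ∈ C⁴`, a `2π`-periodic `g ∈ C⁵` with `|g^{(l)}| ≤ a l` (`1 ≤ l ≤ 5`), and every base angle `θ`: for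
a.e. displacement `w`, `ϑ ↦ g(α_w(ϑ))` is `C⁴` at `θ`, `|∂ᵏ(g∘α_w)(θ)| ≤ Σ_{1≤l≤k} a_l·P_{k,l}(X_w)` and, for every reference `t`,
`|∂ᵏ(g∘α_w)(θ) − g^{(k)}(t)| ≤ Σ_{1≤l<k} a_l·P_{k,l}(X_w) + a_k·|α_w′(θ)ᵏ − 1| + a_{k+1}·|⟨α_w(θ) − t⟩|` (`1 ≤ k ≤ 4`), and
`|g(α_w(θ)) − g(t)| ≤ a_1·|⟨α_w(θ) − t⟩|`; here `X_w = certAngleJets r w θ` and `⟨·⟩` is the representative in `(−π, π]`. -/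
theorem ae_jmeas_chain_bounds_certAngle (hr : ContDiff ℝ 4 r) (hg : ContDiff ℝ 5 g) (hper : Function.Periodic g (2 * π))
    (ha : ∀ l, 1 ≤ l → l ≤ 5 → ∀ x, |iteratedDeriv l g x| ≤ a l) (θ : ℝ) :
    ∀ᵐ w ∂jmeas, ContDiffAt ℝ 4 (fun ϑ : ℝ => g (certAngle r w ϑ)) θ ∧
      (∀ k, 1 ≤ k → k ≤ 4 →
        |iteratedDeriv k (fun ϑ : ℝ => g (certAngle r w ϑ)) θ| ≤ ∑ l ∈ Finset.Icc 1 k, a l * bellP k l (certAngleJets r w θ)) ∧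
      (∀ k, 1 ≤ k → k ≤ 4 → ∀ t : ℝ,
        |iteratedDeriv k (fun ϑ : ℝ => g (certAngle r w ϑ)) θ - iteratedDeriv k g t| ≤
          (∑ l ∈ Finset.Ico 1 k, a l * bellP k l (certAngleJets r w θ)) + a k * |iteratedDeriv 1 (certAngle r w) θ ^ k - 1| +
            a (k + 1) * |toIocMod Real.two_pi_pos (-π) (certAngle r w θ - t)|) ∧
      (∀ t : ℝ, |g (certAngle r w θ) - g t| ≤ a 1 * |toIocMod Real.two_pi_pos (-π) (certAngle r w θ - t)|) := by
  have hg4 : ContDiff ℝ 4 g := hg.of_le (by norm_num)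
  have ha4 : ∀ l, 1 ≤ l → l ≤ 4 → ∀ x, |iteratedDeriv l g x| ≤ a l := fun l h1 h4 => ha l h1 (h4.trans (by norm_num))
  refine (ae_jmeas_contDiffAt_certAngle hr θ).mono fun w hw => ?_
  -- an open chart around `θ` on which the displaced angle is `C⁴`
  obtain ⟨u, u_open, hθu, hu⟩ := hw.contDiffOn' le_rfl (by simp)
  have hU : ContDiffOn ℝ 4 (certAngle r w) u := hu.mono fun x hx => ⟨Set.mem_insert_of_mem _ (Set.mem_univ _), hx⟩
  refine ⟨?_, ?_, ?_, ?_⟩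
  · exact ContDiffAt.comp θ hg4.contDiffAt hw
  · intro k hk1 hk
    exact abs_iteratedDeriv_comp_le_bellP u_open hg4 hU hθu ha4 hk1 hk
  · intro k hk1 hk t
    have h := abs_iteratedDeriv_comp_sub_ref_le u_open hg4 hU hθu ha4 hk1 hk t
    have hinc : |iteratedDeriv k g (certAngle r w θ) - iteratedDeriv k g t| ≤ a (k + 1) * |toIocMod Real.two_pi_pos (-π) (certAngle r w θ - t)| :=
      abs_iteratedDeriv_sub_le_of_periodic (hg.of_le (by exact_mod_cast Nat.succ_le_of_lt (Nat.lt_of_le_of_lt hk (by norm_num)))) hper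
        (ha (k + 1) (Nat.le_add_left 1 k) (by omega)) _ _
    exact h.trans (add_le_add le_rfl hinc)
  · intro t
    have h := abs_iteratedDeriv_sub_le_of_periodic (k := 0) (hg.of_le (by norm_num)) hper (ha 1 le_rfl (by norm_num)) (certAngle r w θ) t
    simpa only [iteratedDeriv_zero] using h

end ChainAE

end Summit.HubbardSuperconductivity.HubbardSuperconductivity.Theorems.KLRegimeSplit

end
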